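import Mathlib.RingTheory.MvPolynomial.Ideal
import Mathlib.RingTheory.MvPolynomial.Basic
import Mathlib.Algebra.MvPolynomial.Rename
import Mathlib.RingTheory.Polynomial.Basic
import Mathlib.Algebra.CharP.Lemmas
import Mathlib.Data.Nat.Choose.Dvd

/-!
# Fedder's test for double points `z² + φ(x, y)` in odd characteristic

Support file for crux stmt-ResolutionOfSingularities-15315
(`FrobeniusLadder.FInjectiveMacaulayfication`, line `Sketch`): stub `stub_doublePointFedderOdd`.

Let `k` be a field of odd characteristic `p` and `φ ∈ k[X₀, X₁]`. By Fedder's criterion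
([Fedder1983], Prop. 1.7; `Fedder.fedder_criterion_origin` in the tree) the hypersurface double point
`k[X₀, X₁, X₂]_{(X)}/(X₂² + φ)` is F-injective (equivalently, satisfies the per-stalk clause of the
crux) iff `(X₂² + φ)^(p-1) ∉ (X₀^p, X₁^p, X₂^p)`. We reduce this to a condition on the plane curve
`φ` alone:

* `stub_doublePointFedderOdd` — `(X₂² + φ)^(p-1) ∉ (X₀^p, X₁^p, X₂^p)` iff
  `φ^((p-1)/2) ∉ (X₀^p, X₁^p)`.

Proof. Write `p - 1 = 2h`. By the binomial theorem
`(X₂² + φ)^(2h) = Σ_{j ≤ 2h} C(2h, j) X₂^(2j) φ^(2h-j)`. If `φ^h ∈ (X₀^p, X₁^p)` then every summand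
lies in `M = (X₀^p, X₁^p, X₂^p)`: for `j ≤ h` because `φ^(2h-j) = φ^h φ^(h-j)`, for `j > h` because
`2j ≥ p`. Conversely, membership in the monomial ideal `M` means that every monomial of the support
has an exponent `≥ p` (`mem_span_X_pow_iff`); if `φ^h ∉ (X₀^p, X₁^p)`, pick a monomial `x^a y^b`
(`a, b < p`) of `φ^h`; the coefficient of `x^a y^b z^(2h)` in `(X₂² + φ)^(2h)` is
`C(2h, h) · coeff_{x^a y^b}(φ^h) ≠ 0` (only the summand `j = h` contributes, the others having the
wrong `z`-degree, and `p ∤ C(p-1, h)`), a monomial with all exponents `< p`.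

References: [Fedder1983] R. Fedder, F-purity and rational singularity, Trans. AMS 278 (1983),
Prop. 1.7 (the criterion; the reduction itself is folklore).
-/

-- single-problem summit: the doubled namespace component `ResolutionOfSingularities` is forced
set_option linter.dupNamespace false

namespace Summit.ResolutionOfSingularities.ResolutionOfSingularities.Theorems.FInjectiveMacaulayfication.DoublePointFedder

open MvPolynomial

variable {k : Type} [Field k]

/-- Membership in the monomial ideal `(Xᵢ^p : i)`: a polynomial lies in it iff every monomial of its
support has some exponent `≥ p`. [folklore] -/
theorem mem_span_X_pow_iff {σ : Type} (p : ℕ) (f : MvPolynomial σ k) :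
    f ∈ Ideal.span (Set.range fun i : σ => (X i : MvPolynomial σ k) ^ p) ↔
      ∀ m ∈ f.support, ∃ i : σ, p ≤ m i := by
  classical
  have hrange : (Set.range fun i : σ => (X i : MvPolynomial σ k) ^ p) =
      (fun s => monomial s (1 : k)) '' Set.range (fun i : σ => Finsupp.single i p) := by
    rw [← Set.range_comp]
    refine congrArg Set.range (funext fun i => ?_)
    simp only [Function.comp_apply, X_pow_eq_monomial]
  rw [hrange, mem_ideal_span_monomial_image]
  refine forall₂_congr fun m _ => ⟨?_, ?_⟩
  · rintro ⟨_, ⟨i, rfl⟩, hle⟩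
    exact ⟨i, by simpa using Finsupp.single_le_iff.mp hle⟩
  · rintro ⟨i, hi⟩
    exact ⟨_, ⟨i, rfl⟩, Finsupp.single_le_iff.mpr (by simpa using hi)⟩

/-- In characteristic `p`, the binomial coefficients `C(n, j)` with `j ≤ n < p` are non-zero
(`p ∤ n!`). [folklore] -/
theorem cast_choose_ne_zero (p : ℕ) [hp : Fact p.Prime] [CharP k p] {n j : ℕ} (hj : j ≤ n)
    (hn : n < p) : ((n.choose j : ℕ) : k) ≠ 0 := by
  intro h
  rw [CharP.cast_eq_zero_iff k p] at h
  exact hp.out.one_lt.ne' ((hp.out.coprime_choose_of_lt hn hj).eq_one_of_dvd h)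

/-- The embedding `k[X₀, X₁] → k[X₀, X₁, X₂]` maps `(X₀^p, X₁^p)` into `(X₀^p, X₁^p, X₂^p)`.
[folklore] -/
theorem rename_mem_of_mem (p : ℕ) {f : MvPolynomial (Fin 2) k}
    (hf : f ∈ Ideal.span (Set.range fun i : Fin 2 => (X i : MvPolynomial (Fin 2) k) ^ p)) :
    rename Fin.castSucc f ∈
      Ideal.span (Set.range fun i : Fin 3 => (X i : MvPolynomial (Fin 3) k) ^ p) := by
  have h := Ideal.mem_map_of_mem
    (rename (Fin.castSucc : Fin 2 → Fin 3) : MvPolynomial (Fin 2) k →ₐ[k] MvPolynomial (Fin 3) k) hf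
  rw [Ideal.map_span] at h
  refine Ideal.span_mono ?_ h
  rintro _ ⟨_, ⟨i, rfl⟩, rfl⟩
  exact ⟨Fin.castSucc i, by simp only [map_pow, rename_X]⟩

/-- `X₂` is not one of the first two variables: `2 ∉ range (Fin.castSucc : Fin 2 → Fin 3)`.
[folklore] -/
theorem two_notMem_range_castSucc : (2 : Fin 3) ∉ Set.range (Fin.castSucc : Fin 2 → Fin 3) := by
  rintro ⟨i, hi⟩
  exact absurd hi (Fin.castSucc_ne_last i)

/-- **Fedder's test for a double point `X₂² + φ(X₀, X₁)` in odd characteristic `p`** reduces to the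
plane curve: `(X₂² + φ)^(p-1) ∉ (X₀^p, X₁^p, X₂^p)` iff `φ^((p-1)/2) ∉ (X₀^p, X₁^p)`. (Binomial
expansion in `X₂²`; the summands have distinct `X₂`-degrees `2j`, the binomial coefficients
`C(p-1, j)` are units mod `p`, and `2j < p ⇔ p - 1 - j ≥ (p-1)/2`.) Stub `stub_doublePointFedderOdd`
of line `Sketch`; the surrounding criterion is [cite: Fedder1983, Prop. 1.7], the reduction is
[folklore]. -/
theorem stub_doublePointFedderOdd : ∀ (p : ℕ) [Fact p.Prime], p ≠ 2 → ∀ (k : Type) [Field k] [CharP k p]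
    (φ : MvPolynomial (Fin 2) k),
    ((MvPolynomial.X 2 ^ 2 + MvPolynomial.rename Fin.castSucc φ : MvPolynomial (Fin 3) k) ^ (p - 1) ∉
        Ideal.span (Set.range fun i : Fin 3 => (MvPolynomial.X i : MvPolynomial (Fin 3) k) ^ p) ↔
      φ ^ ((p - 1) / 2) ∉ Ideal.span (Set.range fun i : Fin 2 => (MvPolynomial.X i : MvPolynomial (Fin 2) k) ^ p)) := by
  intro p hp hp2 k _ _ φ
  classical
  obtain ⟨m, hm⟩ := hp.out.odd_of_ne_two hp2
  have h2 : (p - 1) / 2 = m := by omega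
  have h1 : p - 1 = 2 * m := by omega
  rw [h2, h1]
  refine not_congr ⟨fun hsum => ?_, fun hφ => ?_⟩
  · -- `(X₂² + φ)^(2m) ∈ M₃ → φ^m ∈ M₂`, by contraposition: a witness monomial
    by_contra hφ
    rw [mem_span_X_pow_iff] at hsum hφ
    push Not at hφ
    obtain ⟨m₀, hm₀, hlt⟩ := hφ
    set ψ : MvPolynomial (Fin 3) k := rename Fin.castSucc φ with hψ
    -- the binomial expansion
    have hexp : (X 2 ^ 2 + ψ) ^ (2 * m) = ∑ j ∈ Finset.range (2 * m + 1),
        monomial (Finsupp.single (2 : Fin 3) (2 * j)) (((2 * m).choose j : ℕ) : k) *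
          ψ ^ (2 * m - j) := by
      rw [add_pow]
      refine Finset.sum_congr rfl fun j _ => ?_
      rw [← pow_mul, X_pow_eq_monomial,
        mul_comm _ (((2 * m).choose j : ℕ) : MvPolynomial (Fin 3) k), ← mul_assoc,
        ← map_natCast (C : k →+* MvPolynomial (Fin 3) k) ((2 * m).choose j), C_mul_monomial, mul_one]
    -- the witness monomial `z^(2m) · m₀`
    set M : Fin 3 →₀ ℕ := Finsupp.single (2 : Fin 3) (2 * m) + Finsupp.mapDomain Fin.castSucc m₀
      with hM
    have hM2 : M 2 = 2 * m := by
      rw [hM, Finsupp.add_apply, Finsupp.single_eq_same,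
        Finsupp.mapDomain_notin_range _ _ two_notMem_range_castSucc, add_zero]
    have hMc : ∀ i : Fin 2, M (Fin.castSucc i) = m₀ i := by
      intro i
      rw [hM, Finsupp.add_apply, Finsupp.mapDomain_apply (Fin.castSucc_injective 2),
        Finsupp.single_eq_of_ne (show Fin.castSucc i ≠ (2 : Fin 3) from Fin.castSucc_ne_last i),
        zero_add]
    have hcoeff : coeff M ((X 2 ^ 2 + ψ) ^ (2 * m)) = ((2 * m).choose m : k) * coeff m₀ (φ ^ m) := by
      rw [hexp, coeff_sum, Finset.sum_eq_single m]
      · rw [coeff_monomial_mul', if_pos (by rw [hM]; exact self_le_add_right _ _)]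
        congr 1
        have hsub : M - Finsupp.single (2 : Fin 3) (2 * m) = Finsupp.mapDomain Fin.castSucc m₀ := by
          rw [hM, add_tsub_cancel_left]
        rw [hsub, show 2 * m - m = m by omega, hψ, ← map_pow,
          coeff_rename_mapDomain _ (Fin.castSucc_injective 2)]
      · intro j hj hjm
        rw [coeff_monomial_mul']
        split_ifs with hle
        · rw [hψ, ← map_pow, coeff_rename_eq_zero, mul_zero]
          intro u hu
          exfalso
          have h2j : 2 * j ≤ M 2 := Finsupp.single_le_iff.mp hle
          have hu2 := DFunLike.congr_fun hu 2
          rw [Finsupp.mapDomain_notin_range _ _ two_notMem_range_castSucc, Finsupp.tsub_apply,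
            Finsupp.single_eq_same, hM2] at hu2
          rw [hM2] at h2j
          omega
        · rfl
      · intro hm'
        exact absurd (Finset.mem_range.mpr (by omega)) hm'
    have hMsupp : M ∈ ((X 2 ^ 2 + ψ) ^ (2 * m)).support := by
      rw [mem_support_iff, hcoeff]
      exact mul_ne_zero (cast_choose_ne_zero p (by omega) (by omega)) (mem_support_iff.mp hm₀)
    obtain ⟨i, hi⟩ := hsum M hMsupp
    rcases Fin.eq_castSucc_or_eq_last i with ⟨i, rfl⟩ | rfl
    · rw [hMc] at hi
      exact absurd hi (not_le.mpr (hlt i))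
    · change p ≤ M 2 at hi
      rw [hM2] at hi
      omega
  · -- `φ^m ∈ M₂ → (X₂² + φ)^(2m) ∈ M₃`, termwise
    rw [add_pow]
    refine Ideal.sum_mem _ fun j hj => ?_
    rw [Finset.mem_range] at hj
    refine Ideal.mul_mem_right _ _ ?_
    rcases le_or_gt j m with hjm | hjm
    · refine Ideal.mul_mem_left _ _ ?_
      rw [← map_pow, show 2 * m - j = m + (m - j) by omega, pow_add]
      exact rename_mem_of_mem p (Ideal.mul_mem_right _ _ hφ)
    · refine Ideal.mul_mem_right _ _ ?_
      rw [← pow_mul, show 2 * j = p + (2 * j - p) by omega, pow_add]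
      exact Ideal.mul_mem_right _ _ (Ideal.subset_span ⟨2, rfl⟩)

end Summit.ResolutionOfSingularities.ResolutionOfSingularities.Theorems.FInjectiveMacaulayfication.DoublePointFedder
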